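import Mathlib

/-!
# Odd-degree vertices and connections (pub-perc-repro0, P6 §3 (vi))

The graph-theoretic core of the «at least one» half of P6(a) · DUAL-CROSSING (proofs/P6-dualcrossing-p1-v1.md,
§3, step (vi)): in a finite graph whose odd-degree vertices all lie in `T ∪ B`, if the number of odd-degree
vertices in `T` is odd, then some odd-degree vertex of `T` is connected to an odd-degree vertex of `B`.

Proof (as in the paper file): let `R` be the set of vertices reachable from an odd-degree vertex of `T`;
`R` is closed under adjacency, so the induced subgraph on `R` has the same degrees as `G`; if no odd-degree
vertex of `B` were in `R`, the odd-degree vertices of the induced subgraph would be exactly the odd-degree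
vertices of `T`, an odd number — contradicting the handshake lemma
(`SimpleGraph.even_card_odd_degree_vertices`) for the induced subgraph.

In P6 the graph is `(B*_n, 𝒦*)`, `T` the top row and `B` the bottom row of the dual rectangle; the
resulting connection is the open dual top–bottom path.  Imports Mathlib only; no probability.
-/

namespace Summit.Ventures.PercRepro0.OddPath

open SimpleGraph

variable {V : Type*} [Fintype V]

/-- The degree of a vertex in an induced subgraph equals its degree in the ambient graph as soon as all
its neighbours lie in the inducing set (any decidability instances). -/
theorem degree_induce_eq (G : SimpleGraph V) [DecidableRel G.Adj] (s : Set V) [DecidablePred (· ∈ s)]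
    [DecidableRel (G.induce s).Adj] (v : V) (hv : v ∈ s) (hall : ∀ w, G.Adj v w → w ∈ s) :
    (G.induce s).degree ⟨v, hv⟩ = G.degree v := by
  rw [← card_neighborSet_eq_degree, ← card_neighborSet_eq_degree]
  refine Fintype.card_congr ?_
  exact
    { toFun := fun w => ⟨(w.1 : V), (w.2 : G.Adj v (w.1 : V))⟩
      invFun := fun w => ⟨⟨w.1, hall w.1 (w.2 : G.Adj v w.1)⟩, (w.2 : G.Adj v w.1)⟩
      left_inv := fun w => by ext; rfl
      right_inv := fun w => by ext; rfl }

/-- **Odd vertices force a connection.** If every odd-degree vertex lies in `T ∪ B` and the number of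
odd-degree vertices of `T` is odd, then some odd-degree vertex of `T` is reachable from (connected to)
some odd-degree vertex of `B`. -/
theorem exists_odd_reachable (G : SimpleGraph V) [DecidableRel G.Adj] (T B : Finset V)
    (hodd : ∀ v, Odd (G.degree v) → v ∈ T ∨ v ∈ B)
    (hT : Odd (T.filter (fun v => Odd (G.degree v))).card) :
    ∃ t ∈ T, ∃ b ∈ B, Odd (G.degree t) ∧ Odd (G.degree b) ∧ G.Reachable t b := by
  classical
  by_contra hcon
  have hcon' : ∀ t ∈ T, ∀ b ∈ B, Odd (G.degree t) → Odd (G.degree b) → ¬ G.Reachable t b :=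
    fun t ht b hb h1 h2 hr => hcon ⟨t, ht, b, hb, h1, h2, hr⟩
  -- the vertices reachable from an odd-degree vertex of `T`
  let R : Set V := {v | ∃ t ∈ T, Odd (G.degree t) ∧ G.Reachable t v}
  have hclosed : ∀ v ∈ R, ∀ w, G.Adj v w → w ∈ R := by
    rintro v ⟨t, ht, hodd_t, hreach⟩ w hvw
    exact ⟨t, ht, hodd_t, hreach.trans hvw.reachable⟩
  have hdeg : ∀ (v : ↥R), (G.induce R).degree v = G.degree v := fun v =>
    degree_induce_eq G R v.1 v.2 (hclosed v.1 v.2)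
  -- handshake lemma in the induced subgraph
  have heven := even_card_odd_degree_vertices (G.induce R)
  -- the odd-degree vertices of the induced subgraph are exactly the odd-degree vertices of `T`
  have hcard : (Finset.univ.filter (fun v : ↥R => Odd ((G.induce R).degree v))).card
      = (T.filter (fun v => Odd (G.degree v))).card := by
    rw [← Finset.card_map (Function.Embedding.subtype (· ∈ R))]
    congr 1
    ext v
    simp only [Finset.mem_map, Finset.mem_filter, Finset.mem_univ, true_and,
      Function.Embedding.coe_subtype, Subtype.exists, exists_and_right, exists_eq_right]
    constructor
    · rintro ⟨hvR, hoddv⟩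
      rw [hdeg ⟨v, hvR⟩] at hoddv
      refine ⟨?_, hoddv⟩
      obtain ⟨t, ht, hoddt, hreach⟩ := hvR
      rcases hodd v hoddv with hvT | hvB
      · exact hvT
      · exact absurd hreach (hcon' t ht v hvB hoddt hoddv)
    · rintro ⟨hvT, hoddv⟩
      have hvR : v ∈ R := ⟨v, hvT, hoddv, Reachable.refl v⟩
      exact ⟨hvR, by rw [hdeg ⟨v, hvR⟩]; exact hoddv⟩
  rw [hcard] at heven
  exact (Nat.not_even_iff_odd.mpr hT) heven

end Summit.Ventures.PercRepro0.OddPath
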